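import Mathlib.RingTheory.Invariant.Basic
import Mathlib.RingTheory.Ideal.GoingUp
import Mathlib.FieldTheory.IsAlgClosed.Basic
import Literature.NumberTheory.Automorphic.SphericalHeckeEigenvaluesGL
import HarnessLib

/-!
# Characters of algebras of invariants extend (Cartier 1979 §IV Cor. 4.2, the commutative algebra); characters of `ℂ[ℤⁿ]` are
# evaluations at points of `(ℂˣ)ⁿ`

Topic `NumberTheory/Automorphic`; namespace `Literature.NumberTheory.Automorphic` (lane `lit-hodgefound`, Track 2 foundations; seat
`lit-hodgefound-p11`, generation 48, row g48-#8).  THEOREMS ONLY (no definition, no named fact, no instance, no notation): the two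
pieces of commutative algebra behind [CartierCorvallis1979] §IV Cor. 4.2 («every homomorphism `ℋ(G, K) → ℂ` is `f ↦ Sf(χ)` for an
unramified character `χ`, unique up to `W`»), isolated from the group theory so that they serve `GL_n`, `Sp_{2n}` and `U_N` alike.

## The mathematics

(1) EXTENSION OF CHARACTERS FROM INVARIANTS.  Let `k` be an algebraically closed field, `B` a commutative `k`-algebra with an
action of a finite group `G` by ring automorphisms, and `A ⊆ B` a `k`-subalgebra containing the fixed points `B^G`.  Then every
`k`-algebra homomorphism `φ : A → k` extends to some `Ψ : B → k`.  PROOF: `B` is integral over `A` (every `b` is a root of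
`∏_g (X - g b) ∈ B^G[X]`; Mathlib's `Algebra.IsInvariant.isIntegral`); `𝔪 = ker φ` is maximal, so by lying-over there is a maximal
`𝔔 ⊂ B` with `𝔔 ∩ A = 𝔪`; `B/𝔔` is a field, integral over `A/𝔪 = k`, hence `= k` (`k` algebraically closed), and
`Ψ = (B → B/𝔔 = k)` extends `φ`.
(2) CHARACTERS OF `k[ℤⁿ]`: every monoid homomorphism `χ : ℤⁿ → (R, ·)` is `m ↦ ∏ zᵢ^{mᵢ}` with `zᵢ = χ(eᵢ) ∈ Rˣ`; for `R = ℂ` this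
is the tree's `laurentMonomialHom z`, so every `ℂ`-algebra homomorphism `ℂ[ℤⁿ] → ℂ` is an evaluation `laurentEvalAt z`.
(3) `ev_χ(f_* x) = ev_{χ ∘ f}(x)` for push-forwards along `f : M → M'`.

## What is formalised

* §1 **`exists_algHom_extend_of_fixedPoints`** ((1) above).
* §2 `map_ofAdd_eq_coe_prod_toHomUnits` (`χ(m) = ∏ χ(eᵢ)^{mᵢ}` in `Rˣ`), **`exists_laurentMonomialHom_eq`**,
  **`exists_laurentEvalAt_eq`** (every `ℂ[ℤⁿ] →ₐ[ℂ] ℂ` is `laurentEvalAt z`).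
* §3 `lift_mapDomain` (naturality of `AddMonoidAlgebra.lift` in the lattice).

## References
* [CartierCorvallis1979] P. Cartier, *Representations of 𝔭-adic groups: a survey*, PSPM 33.1 (1979), §IV Cor. 4.2 and its proof.
* [BourbakiAC5to7] N. Bourbaki, *Algèbre commutative*, Ch. V §1 no. 9 Prop. 22, §2 no. 1 Thm. 1 (integrality over invariants;
  lying over).
* [Macdonald1971] I. G. Macdonald, *Spherical functions on a group of p-adic type*, Madras (1971), Ch. III §3.
-/

noncomputable section

namespace Literature.NumberTheory.Automorphic

/-! ## §1 Characters of a subalgebra containing the invariants extend -/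

section Extend

/-- **Characters extend from the invariants**: for `k` algebraically closed, `B` a commutative `k`-algebra with an action of a
finite group `G` by ring automorphisms and `A ⊆ B` a subalgebra containing `B^G`, every `k`-algebra homomorphism `A → k` is the
restriction of one `B → k` (integrality of `B` over `B^G` + lying over + `B/𝔔 = k`). [cite: CartierCorvallis1979, §IV Cor. 4.2 (proof)]
[cite: BourbakiAC5to7, Ch. V §1 no. 9 Prop. 22] -/
theorem exists_algHom_extend_of_fixedPoints {k : Type*} [Field k] [IsAlgClosed k] {B : Type*} [CommRing B] [Algebra k B]
    {G : Type*} [Group G] [Finite G] [MulSemiringAction G B] (A : Subalgebra k B)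
    (hA : ∀ b : B, (∀ g : G, g • b = b) → b ∈ A) (φ : A →ₐ[k] k) :
    ∃ Ψ : B →ₐ[k] k, ∀ a : A, Ψ a = φ a := by
  classical
  cases nonempty_fintype G
  haveI : Algebra.IsInvariant A B G := ⟨fun b hb => ⟨⟨b, hA b hb⟩, rfl⟩⟩
  haveI : Algebra.IsIntegral A B := Algebra.IsInvariant.isIntegral A B G
  -- `𝔪 = ker φ` is maximal and `A → B` is injective
  have hφs : Function.Surjective φ := fun c => ⟨algebraMap k A c, AlgHom.commutes φ c⟩
  haveI hmax : (RingHom.ker φ).IsMaximal := RingHom.ker_isMaximal_of_surjective φ hφs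
  have hker : RingHom.ker (algebraMap A B) ≤ RingHom.ker φ := by
    rw [(RingHom.injective_iff_ker_eq_bot _).1 (fun x y h => Subtype.ext h)]
    exact bot_le
  -- a maximal `𝔔 ⊂ B` over `𝔪`
  obtain ⟨Q, hQ, hQA⟩ := Ideal.exists_ideal_over_maximal_of_isIntegral (RingHom.ker φ) hker
  letI := Ideal.Quotient.field Q
  have hcompat : ∀ a : A, Ideal.Quotient.mk Q (a : B) = algebraMap k (B ⧸ Q) (φ a) := by
    intro a
    rw [← Ideal.Quotient.mk_algebraMap, Ideal.Quotient.eq]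
    have hmem : a - algebraMap k A (φ a) ∈ RingHom.ker φ := by
      rw [RingHom.mem_ker, map_sub, AlgHom.commutes, Algebra.algebraMap_self, RingHom.id_apply, sub_self]
    rw [← hQA, Ideal.mem_comap] at hmem
    exact hmem
  -- `B/𝔔` is integral over `k`, hence `= k`
  haveI : Algebra.IsIntegral k (B ⧸ Q) := ⟨fun x => by
    obtain ⟨b, rfl⟩ := Ideal.Quotient.mk_surjective x
    obtain ⟨p, hp, hpb⟩ := Algebra.IsIntegral.isIntegral (R := A) b
    refine ⟨p.map (φ : A →+* k), hp.map _, ?_⟩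
    have hcomp : (algebraMap k (B ⧸ Q)).comp (φ : A →+* k) = (Ideal.Quotient.mk Q).comp (algebraMap A B) :=
      RingHom.ext fun a => (hcompat a).symm
    rw [Polynomial.eval₂_map, hcomp, ← Polynomial.hom_eval₂, hpb, map_zero]⟩
  have hbij := IsAlgClosed.algebraMap_bijective_of_isIntegral (k := k) (K := B ⧸ Q)
  let e : k ≃+* B ⧸ Q := RingEquiv.ofBijective (algebraMap k (B ⧸ Q)) hbij
  refine ⟨{ (e.symm : B ⧸ Q →+* k).comp (Ideal.Quotient.mk Q) with commutes' := fun c => ?_ }, fun a => ?_⟩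
  · show e.symm (Ideal.Quotient.mk Q (algebraMap k B c)) = c
    rw [Ideal.Quotient.mk_algebraMap]
    exact e.symm_apply_apply c
  · show e.symm (Ideal.Quotient.mk Q (a : B)) = φ a
    rw [hcompat]
    exact e.symm_apply_apply (φ a)

end Extend

/-! ## §2 Characters of `ℤⁿ` and of `ℂ[ℤⁿ]` -/

section Laurent

variable {R : Type*} [CommRing R] {n : ℕ}

/-- **`χ(m) = ∏ᵢ χ(eᵢ)^{mᵢ}`** for a monoid homomorphism `χ : ℤⁿ → (R, ·)`, the powers read in `Rˣ` (`χ` takes unit values).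
[cite: CartierCorvallis1979, §IV Cor. 4.2] -/
theorem map_ofAdd_eq_coe_prod_toHomUnits (χ : Multiplicative (Fin n → ℤ) →* R) (m : Fin n → ℤ) :
    χ (Multiplicative.ofAdd m) = ((∏ i, χ.toHomUnits (Multiplicative.ofAdd (Pi.single i (1 : ℤ))) ^ (m i) : Rˣ) : R) := by
  rw [← MonoidHom.coe_toHomUnits]
  congr 1
  conv_lhs => rw [← Finset.univ_sum_single m, ofAdd_sum, map_prod]
  refine Finset.prod_congr rfl fun i _ => ?_
  rw [← map_zpow, ← ofAdd_zsmul]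
  congr 2
  funext j
  rw [Pi.smul_apply, smul_eq_mul, Pi.single_apply, Pi.single_apply]
  split_ifs <;> simp

/-- **Every character of `ℤⁿ` is a monomial character**: `χ = laurentMonomialHom z` with `zᵢ = χ(eᵢ) ∈ ℂˣ`.
[cite: CartierCorvallis1979, §IV Cor. 4.2] -/
theorem exists_laurentMonomialHom_eq (χ : Multiplicative (Fin n → ℤ) →* ℂ) : ∃ z : Fin n → ℂˣ, laurentMonomialHom z = χ :=
  ⟨fun i => χ.toHomUnits (Multiplicative.ofAdd (Pi.single i (1 : ℤ))), MonoidHom.ext fun m => by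
    rw [show m = Multiplicative.ofAdd (Multiplicative.toAdd m) from rfl, map_ofAdd_eq_coe_prod_toHomUnits χ (Multiplicative.toAdd m)]
    rfl⟩

/-- **Every `ℂ`-algebra homomorphism `ℂ[ℤⁿ] → ℂ` is an evaluation `f ↦ f(z)` at a point `z ∈ (ℂˣ)ⁿ`.**
[cite: CartierCorvallis1979, §IV Cor. 4.2] -/
theorem exists_laurentEvalAt_eq (Ψ : AddMonoidAlgebra ℂ (Fin n → ℤ) →ₐ[ℂ] ℂ) : ∃ z : Fin n → ℂˣ, laurentEvalAt z = Ψ := by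
  obtain ⟨z, hz⟩ := exists_laurentMonomialHom_eq ((AddMonoidAlgebra.lift ℂ ℂ (Fin n → ℤ)).symm Ψ)
  refine ⟨z, ?_⟩
  rw [laurentEvalAt, hz, Equiv.apply_symm_apply]

end Laurent

/-! ## §3 Naturality of evaluation -/

section Natural

variable {R : Type*} [CommRing R] {M M' : Type*} [AddCommMonoid M] [AddCommMonoid M']

/-- **`ev_χ(f_* x) = ev_{χ∘f}(x)`**: evaluating the push-forward of `x ∈ R[M]` along an additive map `f : M → M'` at a character
`χ` of `M'` is evaluating `x` at `χ ∘ f`. [cite: CartierCorvallis1979, §IV (4.2)–(4.4)] -/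
theorem lift_mapDomain (f : M →+ M') (χ : Multiplicative M' →* R) (x : AddMonoidAlgebra R M) :
    AddMonoidAlgebra.lift R R M' χ (AddMonoidAlgebra.mapDomain f x) =
      AddMonoidAlgebra.lift R R M (χ.comp (AddMonoidHom.toMultiplicative f)) x := by
  induction x using AddMonoidAlgebra.induction_linear with
  | zero => rw [AddMonoidAlgebra.mapDomain_zero, map_zero, map_zero]
  | add x y hx hy => rw [AddMonoidAlgebra.mapDomain_add, map_add, map_add, hx, hy]
  | single m c => rw [AddMonoidAlgebra.mapDomain_single, AddMonoidAlgebra.lift_single, AddMonoidAlgebra.lift_single]; rfl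

end Natural

end Literature.NumberTheory.Automorphic

end
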